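import Summits.Langlands.Langlands.Theses.RootDecomp2

/-!
# Proof of the split glue `RootDecomp2.GenericFibreAtP_of_split` (lens-6 g18 `PadicFibreCarving`)

`TotallyRealOrCMWeightTwoRankTwoFibreAtP → CMHigherWeightRankTwoFibreAtP → HigherRankRegularFibreAtP → DarkFibreAtP → GenericFibreAtP`
— pure logic: three excluded middles on the inlined sector dials.  The IDENTICAL tactic block is certified in the node file
(`PadicFibreCarving.GenericFibreAtP_of_split`, rc 0, axioms standard).  Propose AFTER the split has rendered the four children and the
glue item (check the rendered decl name; default requested `GenericFibreAtP_of_split`).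
-/

set_option linter.dupNamespace false -- project-wide option; `Summit.Langlands.Langlands` is the mandated namespace

namespace Summit.Langlands.Langlands.Theorems

open Summit.Langlands.Langlands.Theses

/-- **Glue of the in-place split of GEN_p** (route-Langlands-RootDecomp2 rev 1 @971191c80cf9, item stmt-Langlands-28444):
`LOW → CMH → HR → DK → GenericFibreAtP` by three excluded middles on the inlined sector dials (TR/CM ∧ regular; n ≤ 2; the
parallel-weight-two-up-to-twist clause).  Pure logic; the identical tactic block is certified in the lens-6-g18 node `PadicFibreCarving`. -/
theorem GenericFibreAtP_of_split_proof : RootDecomp2.GenericFibreAtP_of_split := by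
  intro hLOW hCMH hHR hDK K _ _ n hcpt hn π hL
  by_cases hb : ((NumberField.IsTotallyReal K ∨ NumberField.IsCMField K) ∧ (∃ T : Literature.NumberTheory.Automorphic.InfinityType K n, π.1.HasInfinityType T ∧ T.IsLAlgebraic ∧ T.IsRegular))
  · obtain ⟨hTC, hreg⟩ := hb
    by_cases h2 : n ≤ 2
    · rcases hTC with hT | hC
      · exact hLOW K n hcpt hn π hL ⟨hreg, h2, Or.inl hT⟩
      · by_cases hg : (∃ T : Literature.NumberTheory.Automorphic.InfinityType K n, π.1.HasInfinityType T ∧ ∀ σ : K →+* ℂ, ∃ s : ℂ, (T σ).map Literature.NumberTheory.Automorphic.ArchWeight.a = (Literature.NumberTheory.Automorphic.weightZeroInfinityType n K σ).map (fun p => p.a + s))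
        · exact hLOW K n hcpt hn π hL ⟨hreg, h2, Or.inr ⟨hC, hg⟩⟩
        · exact hCMH K n hcpt hn π hL ⟨hC, hreg, h2, hg⟩
    · exact hHR K n hcpt hn π hL ⟨hTC, hreg, by omega⟩
  · exact hDK K n hcpt hn π hL hb

end Summit.Langlands.Langlands.Theorems
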